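import Summits.Ventures.QEC.Census.CertCoverBatch
import Summits.Ventures.QEC.Census.BB.A1s_n168_k6_98626cb8.CoreDefs
import HarnessLib

set_option Elab.async false
set_option maxRecDepth 200000

/-!
# `[[168,6,16]]` one-level cover certificate of `A1s_n168_k6_98626cb8` — LEVEL-1→0 coset problems 0…20 (deep problems [5] excluded: `ProbDeep*.lean`) as COMPACT data
(`ProbData`: U, f, σ, y₀, allow; qec-type-10 `CertCoverBatch.mkCoset` rebuilds each `CosetProb` in the kernel) + their verdict
`probsOK cov covR hx hx1 D1 lxd 14` (one `decide +kernel`; 20 problems, depths f=0:9 f=1:7 f=2:3 f=3:1, est. 297.5 s).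
qec-search-1 g5 (pattern of search-9 g5 `Probs*`); data from JSON `level10.problems` (sha256 2704e96faadf7ca5…). Data + decided check; KERNEL.
-/

namespace Summit.Ventures.QEC.Census.A1s_n168_k6_98626cb8

open Matrix Summit.Ventures.QEC.Census Literature.InformationTheory.QuantumCodes

/-- Problems 0…20 (20): `⟨U, f, σ, y₀, allow⟩`. -/
def probs00 : List ProbData := [
    ⟨48387127250176, 2, 12886605824, 4406637064933, [1048576, 18031990695526400, 27021597764222976]⟩,
    ⟨127569162147584, 0, 21475753985, 35201578700033, []⟩,
    ⟨215564485665537, 0, 38656147971, 140754795641091, []⟩,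
    ⟨570647610753504, 1, 2749853057032, 590444195008503, []⟩,
    ⟨1703146737009184, 1, 1651415203864, 1125903128284119, []⟩,
    ⟨4595975839815680, 1, 27918336065, 4591560608979457, []⟩,
    ⟨5636098754019776, 1, 3299608854608, 1145695426185152, [2251799813685248, 2305843009213693952, 4611686018427387904]⟩,
    ⟨6786190072219008, 1, 5369430112, 4508001971050030, [524288, 9007199254740992]⟩,
    ⟨7905495058810432, 0, 3304978153584, 6755405883726905, []⟩,
    ⟨9064382466099456, 3, 8591114368, 9011605891376587, [1048576, 18014398509481984]⟩,
    ⟨9125972314952448, 1, 17180262529, 9020419165126657, [1, 36028797018963968]⟩,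
    ⟨9152377856736513, 0, 60130198146, 9156732962032615, []⟩,
    ⟨9381110735724802, 0, 111669281925, 17660922490061, []⟩,
    ⟨13532789128037888, 2, 6443237568, 13510798882111488, [0, 8796093022208]⟩,
    ⟨15767001040028032, 2, 1073938656, 13515201226342656, [0, 4611686018427387904]⟩,
    ⟨16903898212663872, 0, 3300682662128, 11272199655195264, []⟩,
    ⟨18089191129227008, 0, 30066737409, 18027618419438308, []⟩,
    ⟨20279405355860608, 0, 3221553440, 2264993957675904, []⟩,
    ⟨21398710334062912, 0, 3298535047472, 20270611403964544, []⟩,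
    ⟨22583968856803840, 1, 10738729280, 22517998136852480, [0]⟩]

set_option maxHeartbeats 400000000 in
/-- Every problem of this chunk passes (`mkCoset` elimination + `cosetOKD` + fast `σ` + depth + `BU`-evenness + label checks). -/
theorem probs00_ok : probsOK A1s_n168_k6_98626cb8.cov covR hx hx1 D1 lxd 14 probs00 = true := by
  decide +kernel

/-- Pointwise form. -/
theorem probs00_all : ∀ x ∈ A1s_n168_k6_98626cb8.probs00, probOK cov covR hx hx1 D1 lxd 14 x = true := by
  have h := probs00_ok
  rwa [probsOK, List.all_eq_true] at h

end Summit.Ventures.QEC.Census.A1s_n168_k6_98626cb8
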